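/-
  HodgeLocusCensusUnitColumnRankDropBandProfile.lean — pub-hlocus ENGINE B (ivhs-2, gen 56), PROBE 22.
  certified instances and evidence bearing on the general Hodge conjecture; no claim.

  KERNEL RANK THEOREMS (evidence class; no census number changes; nothing about HC). THE WHOLE FIRST BAND AT ONCE.
  For a prime p > c, a field K of characteristic p, a field K₀ of characteristic 0 and anchor 229's multiplicity matrix of ×q^c on
  K[x₁,…,x_k]/(xᵢ^{e+2}) at level j (VERBATIM, as in anchors 230/294/296/298/304/307), in the notation of anchor 304's (DROP) and anchor 307's (BAND)
  (labels μ : Fin k → Fin (e+1); s = #{μ ≠ 0}, t = (j + Σμ)/(e+1) − s, m = k − s, T = min (t, m − t − c); for k < 2p + c each label carries the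
  single binomial [T + c ≥ p]·C(m, T + c − p), anchor 307 `rank_charP_add_sum_single_eq_rank_charZero`), write k + c = 2p + r with 0 ≤ r < 2c
  (r = the position of the cell inside the first band 2p − c ≤ k < 2p + c):
  (P1) `single_eq_sum_range_ite`: the label correction is C(k − s, min(u, r − s − u)) if j + Σμ = (e+1)(p − c + s + u) with u ≤ r − s, else 0
      (T + c ≥ p iff p − c ≤ t ≤ p − c + (r − s), and then T + c − p = min(u, r − s − u), u = t − (p − c));
  (P2) `sum_single_eq_sum_sum`: Σ_μ = Σ_{s ≤ r} Σ_{u ≤ r − s} C(k − s, min(u, r − s − u)) · #{μ : s non-zero coordinates, j + Σμ = (e+1)(p − c + s + u)};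
  (PROFILE) `rank_charP_add_sum_sum_eq_rank_charZero` — HEADLINE: for c < p, r < 2c, k + c = 2p + r,
      rank_K + Σ_{s ≤ r} Σ_{u ≤ r − s} C(k − s, min(u, r − s − u)) · #{μ : Fin k → Fin (e+1) : s non-zero coordinates, j + Σμ = (e+1)(p − c + s + u)}
      = rank_{K₀}
      — the drop across the whole first band as ONE label count with binomial weights; r = 0, 1, 2 are anchor 304's (BDRY) ([j = (e+1)(p − c)]),
      anchor 307's (BDRY2) (1, k, …, k, 1) and the third boundary (1, k, k + C(k,2), …, k + e·C(k,2), …, k, 1); for e = 0 (one label) the profile is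
      the folded Pascal row C(k, min(u, r − u)), u = j − (p − c);
  (LOC) `rank_charP_eq_rank_charZero_of_out_of_band`: no drop at the levels j < (e+1)(p − c) and j > (e+1)(p − c + r) — every exceptional level of
      the cell lies in a window of r(e+1) + 1 consecutive levels centred at (k − c)(e+1)/2 (`sum_sum_eq_zero_of_out_of_band`, from Σμ ≤ e·s);
  (ENDS) `rank_charP_add_one_eq_rank_charZero_of_band_end`: at j = (e+1)(p − c) and j = (e+1)(p − c + r) the drop is exactly 1 for every r < 2c
      (`sum_sum_eq_one_of_band_end`: only the zero label contributes, with weight C(k, 0));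
  with the label lemmas (LB) s ≤ Σμ, (UB) Σμ ≤ e·s, (Z) #{μ : no non-zero coordinate, j + Σμ = a} = [j = a].
  10 theorems, 0 defs; imports anchor 307 `…HodgeLocusCensusUnitColumnRankDropBand` by name (hence 304, 296, 294, 293, 230, 229); nothing restated but
  anchor 229's matrix and anchor 307's single-binomial label correction (VERBATIM); no sorries, no axioms, no instances.
-/
import Summits.HodgeConjecture.HodgeConjecture.Theorems.HodgeLocusCensusUnitColumnRankDropBand

set_option linter.dupNamespace false
set_option autoImplicit false

namespace Summit.HodgeConjecture.HodgeConjecture.HodgeLocus.Census.UnitColumnRankDropBandProfile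

open Summit.HodgeConjecture.HodgeConjecture.HodgeLocus.Census.ModelNonJumpC1All (colR)
open Summit.HodgeConjecture.HodgeConjecture.HodgeLocus.Census.UnitColumnRankDropBand (rank_charP_add_sum_single_eq_rank_charZero)

/-! ## §1 TWO LABEL INEQUALITIES -/

/-- (LB) a label has at most `Σμ` non-zero coordinates (each is `≥ 1`). -/
theorem card_filter_le_sum_label (k e : ℕ) (μ : Fin k → Fin (e + 1)) :
    (Finset.univ.filter (fun l => (μ l : ℕ) ≠ 0)).card ≤ ∑ i, (μ i : ℕ) := by
  rw [← Finset.sum_filter_of_ne (p := fun l => (μ l : ℕ) ≠ 0) (fun l _ h => h), Finset.card_eq_sum_ones]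
  exact Finset.sum_le_sum (fun l hl => Nat.one_le_iff_ne_zero.mpr (Finset.mem_filter.mp hl).2)

/-- (UB) a label with `s` non-zero coordinates has `Σμ ≤ e·s` (each coordinate is `≤ e`). -/
theorem sum_label_le_mul_card_filter (k e : ℕ) (μ : Fin k → Fin (e + 1)) :
    ∑ i, (μ i : ℕ) ≤ e * (Finset.univ.filter (fun l => (μ l : ℕ) ≠ 0)).card := by
  rw [← Finset.sum_filter_of_ne (p := fun l => (μ l : ℕ) ≠ 0) (fun l _ h => h), Nat.mul_comm, ← smul_eq_mul]
  exact Finset.sum_le_card_nsmul _ _ _ (fun l _ => Nat.lt_succ_iff.mp (μ l).isLt)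

/-- (Z) the only label with no non-zero coordinate is the zero label: the count `#{μ : 0 non-zero coordinates, j + Σμ = a}` is `[j = a]`. -/
theorem card_filter_card_eq_zero_and_eq (k e j a : ℕ) :
    (Finset.univ.filter (fun μ : Fin k → Fin (e + 1) =>
      (Finset.univ.filter (fun l => (μ l : ℕ) ≠ 0)).card = 0 ∧ j + ∑ i, (μ i : ℕ) = a)).card = if j = a then 1 else 0 := by
  have h0 : ∀ μ : Fin k → Fin (e + 1), (Finset.univ.filter (fun l => (μ l : ℕ) ≠ 0)).card = 0 ↔ μ = fun _ => 0 := by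
    intro μ
    rw [Finset.card_eq_zero, Finset.filter_eq_empty_iff]
    constructor
    · intro h
      funext l
      exact Fin.ext (by have := h (Finset.mem_univ l); simp only [ne_eq, Decidable.not_not] at this; exact this)
    · rintro rfl
      intro l _
      exact fun h => h rfl
  by_cases hj : j = a
  · rw [if_pos hj, Finset.card_eq_one]
    refine ⟨fun _ => 0, Finset.eq_singleton_iff_unique_mem.mpr ⟨?_, fun μ hμ => (h0 μ).mp (Finset.mem_filter.mp hμ).2.1⟩⟩
    rw [Finset.mem_filter]
    refine ⟨Finset.mem_univ _, (h0 _).mpr rfl, ?_⟩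
    simp only [Fin.val_zero, Finset.sum_const_zero, Nat.add_zero]
    exact hj
  · rw [if_neg hj, Finset.card_eq_zero, Finset.filter_eq_empty_iff]
    intro μ _ h
    have h1 := (h0 μ).mp h.1
    subst h1
    simp only [Fin.val_zero, Finset.sum_const_zero, Nat.add_zero] at h
    exact hj h.2

/-! ## §2 THE LABEL CORRECTION ACROSS THE WHOLE FIRST BAND: `k + c = 2p + r`, `c < p` -/

/-- (P1) for `c < p` and `k + c = 2p + r` anchor 307's single-binomial correction of a label `μ` with `s` non-zero coordinates is
`C(k − s, min(u, r − s − u))` if `j + Σμ = (e+1)(p − c + s + u)` with `0 ≤ u ≤ r − s`, and `0` otherwise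
(`T + c ≥ p` iff `p − c ≤ t ≤ m − p = p − c + (r − s)`; then `T + c − p = min(u, r − s − u)` with `u = t − (p − c)`; no hypothesis on `r`). -/
theorem single_eq_sum_range_ite (p k e c j r : ℕ) (hcp : c < p) (hk : k + c = 2 * p + r) (μ : Fin k → Fin (e + 1)) :
    (if (e + 1) ∣ (j + ∑ i, (μ i : ℕ)) ∧ (e + 1) * (Finset.univ.filter (fun l => (μ l : ℕ) ≠ 0)).card ≤ j + ∑ i, (μ i : ℕ) then
      (if k - (Finset.univ.filter (fun l => (μ l : ℕ) ≠ 0)).card < ((j + ∑ i, (μ i : ℕ)) / (e + 1) - (Finset.univ.filter (fun l => (μ l : ℕ) ≠ 0)).card) + c then 0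
       else if min ((j + ∑ i, (μ i : ℕ)) / (e + 1) - (Finset.univ.filter (fun l => (μ l : ℕ) ≠ 0)).card)
           (k - (Finset.univ.filter (fun l => (μ l : ℕ) ≠ 0)).card -
             ((j + ∑ i, (μ i : ℕ)) / (e + 1) - (Finset.univ.filter (fun l => (μ l : ℕ) ≠ 0)).card) - c) + c < p then 0
       else (k - (Finset.univ.filter (fun l => (μ l : ℕ) ≠ 0)).card).choose (min ((j + ∑ i, (μ i : ℕ)) / (e + 1) - (Finset.univ.filter (fun l => (μ l : ℕ) ≠ 0)).card)
           (k - (Finset.univ.filter (fun l => (μ l : ℕ) ≠ 0)).card -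
             ((j + ∑ i, (μ i : ℕ)) / (e + 1) - (Finset.univ.filter (fun l => (μ l : ℕ) ≠ 0)).card) - c) + c - p))
     else 0) =
    ∑ u ∈ Finset.range (r + 1 - (Finset.univ.filter (fun l => (μ l : ℕ) ≠ 0)).card),
      (if j + ∑ i, (μ i : ℕ) = (e + 1) * (p - c + (Finset.univ.filter (fun l => (μ l : ℕ) ≠ 0)).card + u) then
        (k - (Finset.univ.filter (fun l => (μ l : ℕ) ≠ 0)).card).choose (min u (r - (Finset.univ.filter (fun l => (μ l : ℕ) ≠ 0)).card - u)) else 0) := by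
  have hs : (Finset.univ.filter (fun l => (μ l : ℕ) ≠ 0)).card ≤ k :=
    (Finset.card_filter_le _ _).trans_eq (by rw [Finset.card_univ, Fintype.card_fin])
  by_cases hd : (e + 1) ∣ (j + ∑ i, (μ i : ℕ))
  · obtain ⟨q, hq⟩ := hd
    rw [hq]
    simp only [mul_right_inj' (Nat.succ_ne_zero e), Nat.mul_div_cancel_left q (Nat.succ_pos e)]
    by_cases hqs : p - c + (Finset.univ.filter (fun l => (μ l : ℕ) ≠ 0)).card ≤ q
    · rw [Finset.sum_congr rfl (fun u _ => show (if q = p - c + (Finset.univ.filter (fun l => (μ l : ℕ) ≠ 0)).card + u then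
            (k - (Finset.univ.filter (fun l => (μ l : ℕ) ≠ 0)).card).choose (min u (r - (Finset.univ.filter (fun l => (μ l : ℕ) ≠ 0)).card - u)) else 0) =
          (if q - (p - c + (Finset.univ.filter (fun l => (μ l : ℕ) ≠ 0)).card) = u then
            (k - (Finset.univ.filter (fun l => (μ l : ℕ) ≠ 0)).card).choose (min u (r - (Finset.univ.filter (fun l => (μ l : ℕ) ≠ 0)).card - u)) else 0) by
            by_cases h : q = p - c + (Finset.univ.filter (fun l => (μ l : ℕ) ≠ 0)).card + u
            · rw [if_pos h, if_pos (by omega)]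
            · rw [if_neg h, if_neg (by omega)]),
        Finset.sum_ite_eq]
      simp only [Finset.mem_range]
      rw [if_pos ⟨Dvd.intro _ rfl, Nat.mul_le_mul_left (e + 1) (show (Finset.univ.filter (fun l => (μ l : ℕ) ≠ 0)).card ≤ q by omega)⟩]
      by_cases hu : q - (p - c + (Finset.univ.filter (fun l => (μ l : ℕ) ≠ 0)).card) < r + 1 - (Finset.univ.filter (fun l => (μ l : ℕ) ≠ 0)).card
      · have hT1 : p ≤ min (q - (Finset.univ.filter (fun l => (μ l : ℕ) ≠ 0)).card)
            (k - (Finset.univ.filter (fun l => (μ l : ℕ) ≠ 0)).card - (q - (Finset.univ.filter (fun l => (μ l : ℕ) ≠ 0)).card) - c) + c := by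
          rw [Nat.min_def]; split_ifs <;> omega
        have hT2 : min (q - (Finset.univ.filter (fun l => (μ l : ℕ) ≠ 0)).card)
            (k - (Finset.univ.filter (fun l => (μ l : ℕ) ≠ 0)).card - (q - (Finset.univ.filter (fun l => (μ l : ℕ) ≠ 0)).card) - c) + c - p =
            min (q - (p - c + (Finset.univ.filter (fun l => (μ l : ℕ) ≠ 0)).card))
              (r - (Finset.univ.filter (fun l => (μ l : ℕ) ≠ 0)).card - (q - (p - c + (Finset.univ.filter (fun l => (μ l : ℕ) ≠ 0)).card))) := by
          rw [Nat.min_def, Nat.min_def]; split_ifs <;> omega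
        rw [if_pos hu, if_neg (by omega), if_neg (by omega), hT2]
      · rw [if_neg hu]
        split_ifs with hlt hb
        · rfl
        · rfl
        · exfalso
          revert hb
          rw [imp_false, not_not, Nat.min_def]
          split_ifs <;> omega
    · rw [Finset.sum_eq_zero (fun u _ => if_neg (by omega))]
      split_ifs with hF hlt hb
      · rfl
      · rfl
      · exfalso
        revert hb
        rw [imp_false, not_not, Nat.min_def]
        split_ifs <;> omega
      · rfl
  · rw [if_neg (fun h => hd h.1)]
    exact (Finset.sum_eq_zero (fun u _ => if_neg (fun h => hd (by rw [h]; exact Dvd.intro _ rfl)))).symm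

/-- (P2) THE BAND PROFILE AS A LABEL COUNT: for `c < p`, `k + c = 2p + r` the whole correction sum is
`Σ_μ = Σ_{s ≤ r} Σ_{u ≤ r − s} C(k − s, min(u, r − s − u)) · #{μ : s non-zero coordinates, j + Σμ = (e+1)(p − c + s + u)}`
((P1), the labels sorted by their number `s ≤ k` of non-zero coordinates (`Finset.sum_fiberwise_of_maps_to`), `s > r` contributing empty sums). -/
theorem sum_single_eq_sum_sum (p k e c j r : ℕ) (hcp : c < p) (hk : k + c = 2 * p + r) :
    (∑ μ : Fin k → Fin (e + 1),
      (if (e + 1) ∣ (j + ∑ i, (μ i : ℕ)) ∧ (e + 1) * (Finset.univ.filter (fun l => (μ l : ℕ) ≠ 0)).card ≤ j + ∑ i, (μ i : ℕ) then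
        (if k - (Finset.univ.filter (fun l => (μ l : ℕ) ≠ 0)).card < ((j + ∑ i, (μ i : ℕ)) / (e + 1) - (Finset.univ.filter (fun l => (μ l : ℕ) ≠ 0)).card) + c then 0
         else if min ((j + ∑ i, (μ i : ℕ)) / (e + 1) - (Finset.univ.filter (fun l => (μ l : ℕ) ≠ 0)).card)
             (k - (Finset.univ.filter (fun l => (μ l : ℕ) ≠ 0)).card -
               ((j + ∑ i, (μ i : ℕ)) / (e + 1) - (Finset.univ.filter (fun l => (μ l : ℕ) ≠ 0)).card) - c) + c < p then 0
         else (k - (Finset.univ.filter (fun l => (μ l : ℕ) ≠ 0)).card).choose (min ((j + ∑ i, (μ i : ℕ)) / (e + 1) - (Finset.univ.filter (fun l => (μ l : ℕ) ≠ 0)).card)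
             (k - (Finset.univ.filter (fun l => (μ l : ℕ) ≠ 0)).card -
               ((j + ∑ i, (μ i : ℕ)) / (e + 1) - (Finset.univ.filter (fun l => (μ l : ℕ) ≠ 0)).card) - c) + c - p))
       else 0)) =
    (∑ s ∈ Finset.range (r + 1), ∑ u ∈ Finset.range (r + 1 - s), (k - s).choose (min u (r - s - u)) *
        (Finset.univ.filter (fun μ : Fin k → Fin (e + 1) =>
          (Finset.univ.filter (fun l => (μ l : ℕ) ≠ 0)).card = s ∧ j + ∑ i, (μ i : ℕ) = (e + 1) * (p - c + s + u))).card) := by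
  have hS : ∀ μ : Fin k → Fin (e + 1), (Finset.univ.filter (fun l => (μ l : ℕ) ≠ 0)).card ≤ k := fun μ =>
    (Finset.card_filter_le _ _).trans_eq (by rw [Finset.card_univ, Fintype.card_fin])
  rw [Finset.sum_congr rfl (fun μ _ => single_eq_sum_range_ite p k e c j r hcp hk μ),
    ← Finset.sum_fiberwise_of_maps_to (t := Finset.range (k + 1)) (g := fun μ : Fin k → Fin (e + 1) => (Finset.univ.filter (fun l => (μ l : ℕ) ≠ 0)).card)
      (fun μ _ => Finset.mem_range.mpr (Nat.lt_succ_of_le (hS μ)))]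
  rw [Finset.sum_congr rfl (fun s _ => Finset.sum_congr rfl (fun μ hμ => by rw [(Finset.mem_filter.mp hμ).2]))]
  rw [Finset.sum_congr rfl (fun s _ => Finset.sum_comm)]
  simp only [← Finset.sum_filter, Finset.filter_filter, Finset.sum_const, smul_eq_mul]
  rw [Finset.sum_subset (Finset.range_mono (show k + 1 ≤ k + r + 1 by omega)) ?hA]
  case hA =>
    intro s _ hs'
    rw [Finset.mem_range, not_lt] at hs'
    exact Finset.sum_eq_zero (fun u _ => by
      rw [Finset.card_eq_zero.mpr (Finset.filter_eq_empty_iff.mpr (fun μ _ h => absurd h.1 (by have := hS μ; omega))), Nat.zero_mul])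
  rw [Finset.sum_subset (s₁ := Finset.range (r + 1)) (Finset.range_mono (show r + 1 ≤ k + r + 1 by omega)) ?hB]
  case hB =>
    intro s _ hs'
    rw [Finset.mem_range, not_lt] at hs'
    rw [show r + 1 - s = 0 by omega, Finset.range_zero, Finset.sum_empty]
  exact Finset.sum_congr rfl (fun s _ => Finset.sum_congr rfl (fun u _ => Nat.mul_comm _ _))

/-! ## §3 THE BAND PROFILE OF THE CHARACTERISTIC-`p` RANK -/

/-- **(PROFILE) THE RANK DROP ACROSS THE WHOLE FIRST BAND.** For a prime `p`, `c < p`, `r < 2c` and `k = 2p + r − c` variables (i.e. every cell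
`2p − c ≤ k < 2p + c` of anchor 307's first band, `r = k + c − 2p`), anchor 229's multiplicity matrix of `×q^c` on `K[x₁,…,x_k]/(xᵢ^{e+2})` at level
`j` (VERBATIM) satisfies
`rank_K + Σ_{s ≤ r} Σ_{u ≤ r − s} C(k − s, min(u, r − s − u)) · #{μ : Fin k → Fin (e+1) : s non-zero coordinates, j + Σμ = (e+1)(p − c + s + u)} = rank_{K₀}`
((BAND) of anchor 307 and (P2)). The cases `r = 0, 1, 2` are anchor 304's (BDRY) (drop `[j = (e+1)(p − c)]`), anchor 307's (BDRY2) (`1, k, …, k, 1`) and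
PROBE 21's (BDRY3) (`1, k, k + C(k,2), …`); in general the weights `C(k − s, min(u, r − s − u))` are read off here once and for all, and only the
label counts `#{μ : s non-zero coordinates, Σμ = a} = C(k, s) · #{compositions of a into s parts from [1, e]}` remain cell-specific. -/
theorem rank_charP_add_sum_sum_eq_rank_charZero (K K₀ : Type*) [Field K] [Field K₀] (p : ℕ) [CharP K p] [CharZero K₀] (hp : p.Prime)
    (k e c j r : ℕ) (hcp : c < p) (hr : r < 2 * c) (hk : k + c = 2 * p + r) :
    (Matrix.of fun (v : {v : Fin k → Fin (e + 2) // (∑ i, (v i : ℕ)) + j = k * (e + 1)})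
        (m : {m : Fin k → Fin (e + 2) // (∑ i, (m i : ℕ)) + (j + c * (e + 1)) = k * (e + 1)}) =>
      ((((List.flatMap (colR (e + 3)))^[c] [List.ofFn (fun i => (m.1 i : ℕ))]).count (List.ofFn (fun i => (v.1 i : ℕ))) : ℕ) : K)).rank +
      (∑ s ∈ Finset.range (r + 1), ∑ u ∈ Finset.range (r + 1 - s), (k - s).choose (min u (r - s - u)) *
        (Finset.univ.filter (fun μ : Fin k → Fin (e + 1) =>
          (Finset.univ.filter (fun l => (μ l : ℕ) ≠ 0)).card = s ∧ j + ∑ i, (μ i : ℕ) = (e + 1) * (p - c + s + u))).card) =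
    (Matrix.of fun (v : {v : Fin k → Fin (e + 2) // (∑ i, (v i : ℕ)) + j = k * (e + 1)})
        (m : {m : Fin k → Fin (e + 2) // (∑ i, (m i : ℕ)) + (j + c * (e + 1)) = k * (e + 1)}) =>
      ((((List.flatMap (colR (e + 3)))^[c] [List.ofFn (fun i => (m.1 i : ℕ))]).count (List.ofFn (fun i => (v.1 i : ℕ))) : ℕ) : K₀)).rank := by
  rw [← sum_single_eq_sum_sum p k e c j r hcp hk]
  exact rank_charP_add_sum_single_eq_rank_charZero K K₀ p hp k e c j hcp (by omega)

/-- (SUM-OUT) outside the band `(e+1)(p − c) ≤ j ≤ (e+1)(p − c + r)` every label count of (PROFILE) vanishes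
(`j > (e+1)(p − c + r)`: `j + Σμ` is too large since `s + u ≤ r`; `j < (e+1)(p − c)`: `Σμ ≤ e·s` by (UB) makes `j + Σμ` too small). -/
theorem sum_sum_eq_zero_of_out_of_band (p k e c j r : ℕ) (hj : j < (e + 1) * (p - c) ∨ (e + 1) * (p - c + r) < j) :
    (∑ s ∈ Finset.range (r + 1), ∑ u ∈ Finset.range (r + 1 - s), (k - s).choose (min u (r - s - u)) *
        (Finset.univ.filter (fun μ : Fin k → Fin (e + 1) =>
          (Finset.univ.filter (fun l => (μ l : ℕ) ≠ 0)).card = s ∧ j + ∑ i, (μ i : ℕ) = (e + 1) * (p - c + s + u))).card) = 0 := by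
  refine Finset.sum_eq_zero (fun s hs => Finset.sum_eq_zero (fun u hu => ?_))
  rw [Finset.mem_range] at hs hu
  rw [Finset.card_eq_zero.mpr (Finset.filter_eq_empty_iff.mpr (fun μ _ h => ?_)), Nat.mul_zero]
  have hub := sum_label_le_mul_card_filter k e μ
  rw [h.1] at hub
  have h1 : (e + 1) * (p - c + s + u) = (e + 1) * (p - c) + (e * s + s) + (e + 1) * u := by ring
  have h2 : (e + 1) * (p - c + r) = (e + 1) * (p - c) + (e + 1) * r := by ring
  have h3 : (e + 1) * u + (e + 1) * s ≤ (e + 1) * r := by rw [← Nat.mul_add]; exact Nat.mul_le_mul_left _ (by omega)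
  have h4 : (e + 1) * s = e * s + s := by ring
  rcases hj with hj | hj <;> omega

/-- **(LOC) NO DROP OUTSIDE THE BAND.** For a prime `p`, `c < p`, `r < 2c`, `k + c = 2p + r` and a level `j < (e+1)(p − c)` or `j > (e+1)(p − c + r)`
the characteristic-`p` rank of anchor 229's multiplicity matrix (VERBATIM) equals the characteristic-`0` rank: all exceptional levels of the cell lie in a
window of `r(e+1) + 1` consecutive levels centred at `(k − c)(e+1)/2` ((PROFILE), (SUM-OUT)). -/
theorem rank_charP_eq_rank_charZero_of_out_of_band (K K₀ : Type*) [Field K] [Field K₀] (p : ℕ) [CharP K p] [CharZero K₀] (hp : p.Prime)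
    (k e c j r : ℕ) (hcp : c < p) (hr : r < 2 * c) (hk : k + c = 2 * p + r)
    (hj : j < (e + 1) * (p - c) ∨ (e + 1) * (p - c + r) < j) :
    (Matrix.of fun (v : {v : Fin k → Fin (e + 2) // (∑ i, (v i : ℕ)) + j = k * (e + 1)})
        (m : {m : Fin k → Fin (e + 2) // (∑ i, (m i : ℕ)) + (j + c * (e + 1)) = k * (e + 1)}) =>
      ((((List.flatMap (colR (e + 3)))^[c] [List.ofFn (fun i => (m.1 i : ℕ))]).count (List.ofFn (fun i => (v.1 i : ℕ))) : ℕ) : K)).rank =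
    (Matrix.of fun (v : {v : Fin k → Fin (e + 2) // (∑ i, (v i : ℕ)) + j = k * (e + 1)})
        (m : {m : Fin k → Fin (e + 2) // (∑ i, (m i : ℕ)) + (j + c * (e + 1)) = k * (e + 1)}) =>
      ((((List.flatMap (colR (e + 3)))^[c] [List.ofFn (fun i => (m.1 i : ℕ))]).count (List.ofFn (fun i => (v.1 i : ℕ))) : ℕ) : K₀)).rank := by
  have h := rank_charP_add_sum_sum_eq_rank_charZero K K₀ p hp k e c j r hcp hr hk
  rw [sum_sum_eq_zero_of_out_of_band p k e c j r hj, Nat.add_zero] at h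
  exact h


/-- (SUM-END) at the two ends `j = (e+1)(p − c)` and `j = (e+1)(p − c + r)` of the band the label count of (PROFILE) is exactly `1`
(only the zero label contributes, through `(s, u) = (0, 0)` resp. `(0, r)`, with weight `C(k, 0) = 1`; (LB), (UB), (Z)). -/
theorem sum_sum_eq_one_of_band_end (p k e c j r : ℕ) (hj : j = (e + 1) * (p - c) ∨ j = (e + 1) * (p - c + r)) :
    (∑ s ∈ Finset.range (r + 1), ∑ u ∈ Finset.range (r + 1 - s), (k - s).choose (min u (r - s - u)) *
        (Finset.univ.filter (fun μ : Fin k → Fin (e + 1) =>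
          (Finset.univ.filter (fun l => (μ l : ℕ) ≠ 0)).card = s ∧ j + ∑ i, (μ i : ℕ) = (e + 1) * (p - c + s + u))).card) = 1 := by
  obtain ⟨u₀, hu0, hju⟩ : ∃ u₀, (u₀ = 0 ∨ u₀ = r) ∧ j = (e + 1) * (p - c) + (e + 1) * u₀ := by
    rcases hj with hj | hj
    · exact ⟨0, Or.inl rfl, by rw [hj]; ring⟩
    · exact ⟨r, Or.inr rfl, by rw [hj, Nat.mul_add]⟩
  have hval : ∀ s ∈ Finset.range (r + 1), ∀ u ∈ Finset.range (r + 1 - s),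
      (k - s).choose (min u (r - s - u)) * (Finset.univ.filter (fun μ : Fin k → Fin (e + 1) =>
        (Finset.univ.filter (fun l => (μ l : ℕ) ≠ 0)).card = s ∧ j + ∑ i, (μ i : ℕ) = (e + 1) * (p - c + s + u))).card =
      if s = 0 ∧ u = u₀ then 1 else 0 := by
    intro s hs u hu
    rw [Finset.mem_range] at hs hu
    have h1 : (e + 1) * (p - c + s + u) = (e + 1) * (p - c) + (e * s + s) + (e + 1) * u := by ring
    have h3 : (e + 1) * u + (e + 1) * s ≤ (e + 1) * r := by rw [← Nat.mul_add]; exact Nat.mul_le_mul_left _ (by omega)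
    have h4 : (e + 1) * s = e * s + s := by ring
    have h5 : (e + 1) * u₀ ≤ (e + 1) * r := Nat.mul_le_mul_left _ (by omega)
    by_cases hs0 : s = 0
    · subst hs0
      rw [card_filter_card_eq_zero_and_eq]
      by_cases huu : u = u₀
      · subst huu
        have hmin : min u (r - 0 - u) = 0 := by
          rcases hu0 with rfl | rfl
          · exact Nat.zero_min _
          · rw [Nat.sub_zero, Nat.sub_self]; exact Nat.min_zero _
        rw [if_pos (by rw [hju]; ring), if_pos ⟨rfl, rfl⟩, Nat.mul_one, Nat.sub_zero, hmin, Nat.choose_zero_right]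
      · rw [if_neg (fun h => huu (Nat.eq_of_mul_eq_mul_left (show 0 < e + 1 by omega) (by omega))), if_neg (fun h => huu h.2),
          Nat.mul_zero]
    · rw [Finset.card_eq_zero.mpr (Finset.filter_eq_empty_iff.mpr (fun μ _ h => ?_)), Nat.mul_zero, if_neg (fun h => hs0 h.1)]
      have hub := sum_label_le_mul_card_filter k e μ
      have hlb := card_filter_le_sum_label k e μ
      rw [h.1] at hub hlb
      rcases hu0 with hu0 | hu0 <;> subst hu0 <;> omega
  rw [Finset.sum_congr rfl (fun s hs => Finset.sum_congr rfl (fun u hu => hval s hs u hu)),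
    Finset.sum_eq_single 0 (fun s _ hs0 => Finset.sum_eq_zero (fun u _ => if_neg (fun h => hs0 h.1)))
      (fun h => absurd (Finset.mem_range.mpr (Nat.succ_pos r)) h),
    Finset.sum_eq_single u₀ (fun u _ hne => if_neg (fun h => hne h.2))
      (fun h => absurd (Finset.mem_range.mpr (show u₀ < r + 1 - 0 by omega)) h),
    if_pos ⟨rfl, rfl⟩]

/-- **(ENDS) THE BAND ENDS ALWAYS DROP BY EXACTLY ONE.** For a prime `p`, `c < p`, `r < 2c`, `k + c = 2p + r` and `j = (e+1)(p − c)` or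
`j = (e+1)(p − c + r)`: `rank_K + 1 = rank_{K₀}` for anchor 229's multiplicity matrix (VERBATIM) — at `r = 0` the two ends coincide and this is
anchor 304's (BDRY) ((PROFILE), (SUM-END)). -/
theorem rank_charP_add_one_eq_rank_charZero_of_band_end (K K₀ : Type*) [Field K] [Field K₀] (p : ℕ) [CharP K p] [CharZero K₀] (hp : p.Prime)
    (k e c j r : ℕ) (hcp : c < p) (hr : r < 2 * c) (hk : k + c = 2 * p + r)
    (hj : j = (e + 1) * (p - c) ∨ j = (e + 1) * (p - c + r)) :
    (Matrix.of fun (v : {v : Fin k → Fin (e + 2) // (∑ i, (v i : ℕ)) + j = k * (e + 1)})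
        (m : {m : Fin k → Fin (e + 2) // (∑ i, (m i : ℕ)) + (j + c * (e + 1)) = k * (e + 1)}) =>
      ((((List.flatMap (colR (e + 3)))^[c] [List.ofFn (fun i => (m.1 i : ℕ))]).count (List.ofFn (fun i => (v.1 i : ℕ))) : ℕ) : K)).rank + 1 =
    (Matrix.of fun (v : {v : Fin k → Fin (e + 2) // (∑ i, (v i : ℕ)) + j = k * (e + 1)})
        (m : {m : Fin k → Fin (e + 2) // (∑ i, (m i : ℕ)) + (j + c * (e + 1)) = k * (e + 1)}) =>
      ((((List.flatMap (colR (e + 3)))^[c] [List.ofFn (fun i => (m.1 i : ℕ))]).count (List.ofFn (fun i => (v.1 i : ℕ))) : ℕ) : K₀)).rank := by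
  have h := rank_charP_add_sum_sum_eq_rank_charZero K K₀ p hp k e c j r hcp hr hk
  rw [sum_sum_eq_one_of_band_end p k e c j r hj] at h
  exact h

end Summit.HodgeConjecture.HodgeConjecture.HodgeLocus.Census.UnitColumnRankDropBandProfile
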